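import Summits.QuantumFields.YangMills.Theorems.SoloBlindOddTorusMixed
import Summits.QuantumFields.YangMills.Theorems.SoloBlindLatticeGapEndpoints
import Literature.MathematicalPhysics.QuantumFieldTheory.LatticeGaugeStrongCouplingProofs
import HarnessLib

/-!
# `HasLatticeMassGap` on the time-zero spatial algebra reduces to antipodal decay
# (solo-QuantumFields-blind, rung D8, part 6)

`HasLatticeMassGap r sch Δ` (a conjunct of `Summit.QuantumFields.YangMills`) asks, for every PAIR
of species `A, B`, for `C` with `|c^{(k)}_{A,B}(S; n)| ≤ C e^{-Δ a_k n}` for all large `k`, all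
tori `2S+1` with `S ≥ L_k`, and ALL `n ≤ S`, where
`c^{(k)}_{A,B}(S; n) = latticeConnectedCorr r.ρ (β k) (2S+1) A B n`.

For species supported on the spatial links of one time slice (`IsTimeZeroSpatial`: spatial
plaquettes and Wilson loops, the glueball fields) this file proves, from parts 1–5 of the rung:

* `latticeConnectedCorr_eq_timeTwoPtMixedSeq` — the pair dictionary (every pair of species):
  the statement's correlator is the mixed time correlation of the two centred torus observables;
* `latticeGapClause_of_hasAntipodalDecay` — **the clause for the pair `(A, B)` follows from
  ANTIPODAL decay of the two DIAGONAL correlators**: `c_{A,A}(S; S) ≤ C_A e^{-Δ a_k S}` and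
  `c_{B,B}(S; S) ≤ C_B e^{-Δ a_k S}` (`S ≥ L_k`, eventually in `k`) — by the endpoint reduction
  of part 4 (log-convexity) and the OS Schwarz inequality of part 5, using only
  `HasWeakCouplingLimit` (`β_k ≥ 0` eventually) and the scheme axioms (`L_k ≥ 1`, `a_k ≤ 1`
  eventually);
* `latticeGapClause_timeZero_iff` — hence on the time-zero spatial algebra the family of clauses
  of `HasLatticeMassGap` is EQUIVALENT to antipodal diagonal decay: what has to be proved there is
  one inequality per observable, at the single separation `n = S` on the torus of period `2S+1`.

This is exact bookkeeping of the reflection-positivity structure, valid for every compact `G`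
(and for `U(1)`): it isolates, but does not touch, the infrared statement.

References: K. Osterwalder, E. Seiler, Ann. Phys. 110 (1978) 440, §2; E. Seiler, LNP 159 (1982)
Ch. 2; M. Lüscher, CMP 54 (1977) 283; A. Jaffe, E. Witten, *Quantum Yang–Mills theory* (2000)
§5. [the reduction is this unit's; ingredients folklore]
-/

open MeasureTheory Filter Topology
open Literature.MathematicalPhysics.QuantumFieldTheory Literature.MathematicalPhysics.QuantumLattice

noncomputable section

namespace Summit.QuantumFields.YangMills.Theorems.SoloBlind

/-! ### Centring the mixed correlation -/

section Torus

variable {d L N : ℕ} [NeZero d] [NeZero L] {G : Type*} [Group G] [TopologicalSpace G]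
  [IsTopologicalGroup G] [CompactSpace G] [MeasurableSpace G] [BorelSpace G]
  (ρ : G →* Matrix (Fin N) (Fin N) ℂ)

/-- `M_{F-a, F₂-b}(s) = M_{F,F₂}(s) - a⟨F₂⟩ - b⟨F⟩ + ab`. [folklore] -/
theorem timeTwoPtMixed_sub_const (hρ : Continuous ρ) (β : ℝ) {F F₂ : GaugeConfig d L G → ℝ}
    (hFm : Measurable F) (hFb : ∃ C : ℝ, ∀ U, |F U| ≤ C) (hGm : Measurable F₂)
    (hGb : ∃ C : ℝ, ∀ U, |F₂ U| ≤ C) (a b : ℝ) (s : ZMod L) :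
    timeTwoPtMixed ρ β (fun U => F U - a) (fun U => F₂ U - b) s =
      timeTwoPtMixed ρ β F F₂ s - a * wilsonExpectation ρ β F₂ - b * wilsonExpectation ρ β F +
        a * b := by
  haveI := isProbabilityMeasure_wilsonMeasure (d := d) (L := L) (G := G) ρ hρ β
  obtain ⟨CF, hCF⟩ := hFb
  obtain ⟨CG, hCG⟩ := hGb
  have hCG0 : 0 ≤ CG := le_trans (abs_nonneg _) (hCG (fun _ => 1))
  have hτm : Measurable fun U : GaugeConfig d L G =>
      F₂ (torusConfigShift (-(Pi.single (0 : Fin d) s : Site d L)) U) :=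
    hGm.comp (torusConfigShift _).measurable
  have iA : Integrable (fun U : GaugeConfig d L G =>
      F U * F₂ (torusConfigShift (-(Pi.single (0 : Fin d) s : Site d L)) U)) (wilsonMeasure ρ β) := by
    refine Integrable.of_bound (hFm.mul hτm).aestronglyMeasurable (CF * CG) (ae_of_all _ fun U => ?_)
    rw [Real.norm_eq_abs, abs_mul]
    exact mul_le_mul (hCF _) (hCG _) (abs_nonneg _) ((abs_nonneg _).trans (hCF U))
  have iF : Integrable F (wilsonMeasure ρ β) :=
    Integrable.of_bound hFm.aestronglyMeasurable CF (ae_of_all _ fun U => by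
      rw [Real.norm_eq_abs]; exact hCF U)
  have iB : Integrable (fun U : GaugeConfig d L G =>
      a * F₂ (torusConfigShift (-(Pi.single (0 : Fin d) s : Site d L)) U)) (wilsonMeasure ρ β) :=
    (Integrable.of_bound hτm.aestronglyMeasurable CG (ae_of_all _ fun U => by
      rw [Real.norm_eq_abs]; exact hCG _)).const_mul a
  have iC : Integrable (fun U : GaugeConfig d L G => b * F U) (wilsonMeasure ρ β) := iF.const_mul b
  have iD : Integrable (fun _ : GaugeConfig d L G => a * b) (wilsonMeasure ρ β) := integrable_const _
  have iAB : Integrable (fun U : GaugeConfig d L G =>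
      F U * F₂ (torusConfigShift (-(Pi.single (0 : Fin d) s : Site d L)) U) -
        a * F₂ (torusConfigShift (-(Pi.single (0 : Fin d) s : Site d L)) U)) (wilsonMeasure ρ β) :=
    iA.sub iB
  have iABC : Integrable (fun U : GaugeConfig d L G =>
      F U * F₂ (torusConfigShift (-(Pi.single (0 : Fin d) s : Site d L)) U) -
        a * F₂ (torusConfigShift (-(Pi.single (0 : Fin d) s : Site d L)) U) - b * F U)
      (wilsonMeasure ρ β) := iAB.sub iC
  have hexp : (fun U : GaugeConfig d L G =>
      (F U - a) * (F₂ (torusConfigShift (-(Pi.single (0 : Fin d) s : Site d L)) U) - b)) =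
      fun U => F U * F₂ (torusConfigShift (-(Pi.single (0 : Fin d) s : Site d L)) U) -
        a * F₂ (torusConfigShift (-(Pi.single (0 : Fin d) s : Site d L)) U) - b * F U + a * b := by
    funext U; ring
  have hshift : wilsonExpectation ρ β
      (fun U => F₂ (torusConfigShift (-(Pi.single (0 : Fin d) s : Site d L)) U)) =
      wilsonExpectation ρ β F₂ :=
    wilsonExpectation_comp_torusConfigShift ρ β _ F₂
  have hconst : ∫ _ : GaugeConfig d L G, a * b ∂(wilsonMeasure ρ β) = a * b := by simp
  simp only [timeTwoPtMixed]
  unfold wilsonExpectation at hshift ⊢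
  rw [hexp, integral_add iABC iD, integral_sub iAB iC, integral_sub iA iB, integral_const_mul,
    integral_const_mul, hshift, hconst]

end Torus

/-! ### The summit's pair correlator -/

section Summit

variable {G : Type} [Group G] [TopologicalSpace G] [IsTopologicalGroup G] [CompactSpace G]
  [MeasurableSpace G] [BorelSpace G]

/-- **Pair dictionary.**  `latticeConnectedCorr ρ β (2S+1) A B n` is the mixed time correlation,
on the odd torus `(ℤ/(2S+1))⁴`, of the two CENTRED torus observables. [this unit's typing of a
folklore identity] -/
theorem latticeConnectedCorr_eq_timeTwoPtMixedSeq {N : ℕ} (ρ : G →* Matrix (Fin N) (Fin N) ℂ)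
    (hρ : Continuous ρ) (β : ℝ) (S : ℕ) (A B : YMSpecies G) (n : ℕ) :
    latticeConnectedCorr ρ β (2 * S + 1) A.F B.F n =
      timeTwoPtMixedSeq ρ β
        (fun U => toTorusObservable (2 * S + 1) A.F U -
          wilsonExpectation ρ β (toTorusObservable (2 * S + 1) A.F))
        (fun U => toTorusObservable (2 * S + 1) B.F U -
          wilsonExpectation ρ β (toTorusObservable (2 * S + 1) B.F)) n := by
  rw [latticeConnectedCorr_eq_wilsonExpectation]
  set F : GaugeConfig 4 (2 * S + 1) G → ℝ := toTorusObservable (2 * S + 1) A.F with hF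
  set F₂ : GaugeConfig 4 (2 * S + 1) G → ℝ := toTorusObservable (2 * S + 1) B.F with hF₂
  have hFm : Measurable F := A.measurable.comp (measurable_torusLift (2 * S + 1))
  have hGm : Measurable F₂ := B.measurable.comp (measurable_torusLift (2 * S + 1))
  have hFb : ∃ C : ℝ, ∀ U, |F U| ≤ C := by
    obtain ⟨C, hC⟩ := A.bounded; exact ⟨C, fun U => hC _⟩
  have hGb : ∃ C : ℝ, ∀ U, |F₂ U| ≤ C := by
    obtain ⟨C, hC⟩ := B.bounded; exact ⟨C, fun U => hC _⟩
  have hprod : toTorusObservable (2 * S + 1)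
        (fun U => A.F U * B.F (configShift (-Pi.single 0 (n : ℤ)) U)) =
      fun U => F U * F₂ (torusConfigShift
        (-(Pi.single (0 : Fin 4) ((n : ℤ) : ZMod (2 * S + 1)) : Site 4 (2 * S + 1))) U) := by
    funext U
    have h := congrFun (toTorusObservable_comp_configShift (G := G) (2 * S + 1)
      (-Pi.single (0 : Fin 4) (n : ℤ)) B.F) U
    have hv : Literature.Probability.LatticeModels.Torus.proj (2 * S + 1)
        (-Pi.single (0 : Fin 4) (n : ℤ)) =
          -(Pi.single (0 : Fin 4) ((n : ℤ) : ZMod (2 * S + 1)) : Site 4 (2 * S + 1)) := by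
      funext i
      by_cases hi : i = 0
      · subst hi; simp
      · simp [hi]
    simp only [toTorusObservable, Function.comp_apply, hv] at h
    simp only [toTorusObservable_apply, hF, hF₂]
    rw [← h]
  rw [hprod, timeTwoPtMixedSeq, timeTwoPtMixed_sub_const ρ hρ β hFm hFb hGm hGb, Int.cast_natCast]
  simp only [timeTwoPtMixed]
  ring

/-- The trivial uniform bound `|c_{A,B}(S; n)| ≤ 2ab` (`|A| ≤ a`, `|B| ≤ b`). [folklore] -/
theorem abs_latticeConnectedCorr_le {N : ℕ} (ρ : G →* Matrix (Fin N) (Fin N) ℂ)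
    (hρ : Continuous ρ) (β : ℝ) (S : ℕ) (A B : YMSpecies G) {a b : ℝ} (ha : ∀ U, |A.F U| ≤ a)
    (hb : ∀ U, |B.F U| ≤ b) (n : ℕ) :
    |latticeConnectedCorr ρ β (2 * S + 1) A.F B.F n| ≤ 2 * (a * b) := by
  have ha0 : 0 ≤ a := (abs_nonneg _).trans (ha (fun _ => 1))
  rw [latticeConnectedCorr_eq_wilsonExpectation]
  have h1 : |wilsonExpectation ρ β (toTorusObservable (2 * S + 1)
      (fun U => A.F U * B.F (configShift (-Pi.single 0 (n : ℤ)) U)))| ≤ a * b :=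
    abs_wilsonExpectation_le_of_abs_le ρ hρ β fun U => by
      rw [toTorusObservable_apply, abs_mul]
      exact mul_le_mul (ha _) (hb _) (abs_nonneg _) ha0
  have h2 : |wilsonExpectation ρ β (toTorusObservable (2 * S + 1) A.F)| ≤ a :=
    abs_wilsonExpectation_le_of_abs_le ρ hρ β fun U => by rw [toTorusObservable_apply]; exact ha _
  have h3 : |wilsonExpectation ρ β (toTorusObservable (2 * S + 1) B.F)| ≤ b :=
    abs_wilsonExpectation_le_of_abs_le ρ hρ β fun U => by rw [toTorusObservable_apply]; exact hb _
  calc |wilsonExpectation ρ β (toTorusObservable (2 * S + 1)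
          (fun U => A.F U * B.F (configShift (-Pi.single 0 (n : ℤ)) U))) -
        wilsonExpectation ρ β (toTorusObservable (2 * S + 1) A.F) *
          wilsonExpectation ρ β (toTorusObservable (2 * S + 1) B.F)|
      ≤ |wilsonExpectation ρ β (toTorusObservable (2 * S + 1)
          (fun U => A.F U * B.F (configShift (-Pi.single 0 (n : ℤ)) U)))| +
        |wilsonExpectation ρ β (toTorusObservable (2 * S + 1) A.F) *
          wilsonExpectation ρ β (toTorusObservable (2 * S + 1) B.F)| := abs_sub _ _
    _ ≤ a * b + a * b := by
        rw [abs_mul]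
        exact add_le_add h1 (mul_le_mul h2 h3 (abs_nonneg _) ha0)
    _ = 2 * (a * b) := by ring

/-! ### Scheme level -/

/-- A species supported on the spatial links of the time slice `t = 0` (the time-zero algebra of
the transfer-matrix formalism). [cite: OsterwalderSeiler1978, §2] -/
def IsTimeZeroSpatial (A : YMSpecies G) : Prop := ∀ e ∈ A.supp, e.1 0 = 0 ∧ e.2 ≠ 0

/-- **Antipodal diagonal decay** of the species `A` along the scheme at rate `Δ`: the statement's
correlator `c_{A,A}(S; n)` at the single ANTIPODAL separation `n = S` of the torus of period
`2S+1` is `≤ C e^{-Δ a_k S}` for all `S ≥ L_k`, eventually in `k` (this unit's weakening of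
the clause of Jaffe–Witten §5). [cite: JaffeWitten2000, §5] -/
def HasAntipodalDecay (r : LatticeRep G) (sch : SpeciesScheme (YMSpecies G)) (Δ : ℝ)
    (A : YMSpecies G) : Prop :=
  ∃ C : ℝ, ∀ᶠ k in atTop, ∀ S : ℕ, sch.L k ≤ S →
    latticeConnectedCorr r.ρ (sch.β k) (2 * S + 1) A.F A.F S ≤
      C * Real.exp (-(Δ * (sch.a k * S)))

/-- The `(A, B)` clause of `HasLatticeMassGap r sch Δ` (tree `HasLatticeMassGap`, one pair).
[cite: JaffeWitten2000, §5] -/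
def LatticeGapClause (r : LatticeRep G) (sch : SpeciesScheme (YMSpecies G)) (Δ : ℝ)
    (A B : YMSpecies G) : Prop :=
  ∃ C : ℝ, ∀ᶠ k in atTop, ∀ S : ℕ, sch.L k ≤ S → ∀ n : ℕ, n ≤ S →
    |latticeConnectedCorr r.ρ (sch.β k) (2 * S + 1) A.F B.F n| ≤
      C * Real.exp (-(Δ * (sch.a k * n)))

/-- `HasLatticeMassGap` is the conjunction of its pair clauses. [definitional] -/
theorem hasLatticeMassGap_iff_forall_clause (r : LatticeRep G) (sch : SpeciesScheme (YMSpecies G))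
    (Δ : ℝ) : HasLatticeMassGap r sch Δ ↔ ∀ A B, LatticeGapClause r sch Δ A B := Iff.rfl

/-- The diagonal clause trivially contains antipodal decay (`n = S`). -/
theorem LatticeGapClause.hasAntipodalDecay {r : LatticeRep G} {sch : SpeciesScheme (YMSpecies G)}
    {Δ : ℝ} {A : YMSpecies G} (h : LatticeGapClause r sch Δ A A) : HasAntipodalDecay r sch Δ A := by
  obtain ⟨C, hC⟩ := h
  exact ⟨C, hC.mono fun k hk S hS => (le_abs_self _).trans (hk S hS S le_rfl)⟩

omit [TopologicalSpace G] [IsTopologicalGroup G] [CompactSpace G] [BorelSpace G] in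
/-- Scheme axiom `a_k L_k → ∞` forces `L_k ≥ 1` eventually. [folklore] -/
theorem eventually_one_le_L (sch : SpeciesScheme (YMSpecies G)) : ∀ᶠ k in atTop, 1 ≤ sch.L k := by
  filter_upwards [sch.tendsto_L.eventually_ge_atTop 1] with k hk
  rcases Nat.eq_zero_or_pos (sch.L k) with h | h
  · rw [h, Nat.cast_zero, mul_zero] at hk
    exact absurd hk (by norm_num)
  · exact h

omit [TopologicalSpace G] [IsTopologicalGroup G] [CompactSpace G] [BorelSpace G] in
/-- Scheme axiom `a_k → 0` forces `a_k ≤ 1` eventually. [folklore] -/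
theorem eventually_a_le_one (sch : SpeciesScheme (YMSpecies G)) : ∀ᶠ k in atTop, sch.a k ≤ 1 :=
  sch.tendsto_a.eventually (Iic_mem_nhds zero_lt_one)

omit [TopologicalSpace G] [IsTopologicalGroup G] [CompactSpace G] [BorelSpace G] in
/-- `HasWeakCouplingLimit` forces `β_k ≥ 0` eventually. [folklore] -/
theorem eventually_beta_nonneg {sch : SpeciesScheme (YMSpecies G)} (hw : sch.HasWeakCouplingLimit) :
    ∀ᶠ k in atTop, 0 ≤ sch.β k :=
  hw.eventually_ge_atTop 0

/-- **Main theorem: the pair clause from antipodal diagonal decay.**  For time-zero spatial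
species `A, B`, a weak-coupling scheme and `Δ ≥ 0`: antipodal decay of `c_{A,A}` and of `c_{B,B}`
at rate `Δ` implies the `(A, B)` clause of `HasLatticeMassGap r sch Δ` (every compact `G`).
[this unit's; from OS positivity on odd tori: endpoint reduction (part 4) + Schwarz (part 5)] -/
theorem latticeGapClause_of_hasAntipodalDecay (r : LatticeRep G) {sch : SpeciesScheme (YMSpecies G)}
    (hw : sch.HasWeakCouplingLimit) {Δ : ℝ} (hΔ : 0 ≤ Δ) {A B : YMSpecies G}
    (hA : IsTimeZeroSpatial A) (hB : IsTimeZeroSpatial B) (hdA : HasAntipodalDecay r sch Δ A)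
    (hdB : HasAntipodalDecay r sch Δ B) : LatticeGapClause r sch Δ A B := by
  obtain ⟨CA, hCA⟩ := hdA
  obtain ⟨CB, hCB⟩ := hdB
  obtain ⟨a0, ha0⟩ := A.bounded
  obtain ⟨b0, hb0⟩ := B.bounded
  set KA : ℝ := max CA (2 * (a0 * a0)) with hKA
  set KB : ℝ := max CB (2 * (b0 * b0)) with hKB
  have hKA0 : 0 ≤ KA := le_max_of_le_right (by
    have := abs_latticeConnectedCorr_le r.ρ r.continuous 0 0 A A ha0 ha0 0
    exact (abs_nonneg _).trans this)
  have hKB0 : 0 ≤ KB := le_max_of_le_right (by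
    have := abs_latticeConnectedCorr_le r.ρ r.continuous 0 0 B B hb0 hb0 0
    exact (abs_nonneg _).trans this)
  refine ⟨Real.sqrt (KA * KB * Real.exp Δ), ?_⟩
  filter_upwards [hCA, hCB, eventually_beta_nonneg hw, eventually_one_le_L sch,
    eventually_a_le_one sch] with k hAk hBk hβk hLk hak
  intro S hS n hn
  have hS1 : 1 ≤ S := hLk.trans hS
  -- the rate at step `k` as a ratio `θ = e^{-Δ a_k} ∈ (0, 1]`, with `θ⁻¹ ≤ e^{Δ}`
  set θ : ℝ := Real.exp (-(Δ * sch.a k)) with hθdef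
  have hθ : 0 < θ := Real.exp_pos _
  have hμ0 : 0 ≤ Δ * sch.a k := mul_nonneg hΔ (sch.a_pos k).le
  have hθ1 : θ ≤ 1 := by rw [hθdef]; exact Real.exp_le_one_iff.mpr (by linarith)
  have hθinv : θ⁻¹ ≤ Real.exp Δ := by
    rw [hθdef, ← Real.exp_neg, neg_neg]
    exact Real.exp_le_exp.mpr (by nlinarith)
  have hθpow : ∀ j : ℕ, Real.exp (-(Δ * (sch.a k * j))) = θ ^ j := fun j => by
    rw [hθdef, ← Real.exp_nat_mul]; ring_nf
  -- the centred torus observables and their hypotheses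
  obtain ⟨hFm, hFb, hF0⟩ := centred_toTorusObservable_hyps r.ρ (sch.β k) S A hA
  obtain ⟨hGm, hGb, hG0⟩ := centred_toTorusObservable_hyps r.ρ (sch.β k) S B hB
  -- full diagonal bounds from the endpoints (part 4)
  have hdiag : ∀ (E : YMSpecies G) (hE : IsTimeZeroSpatial E) {e0 CE : ℝ}
      (he0 : ∀ U, |E.F U| ≤ e0)
      (hEk : ∀ S : ℕ, sch.L k ≤ S → latticeConnectedCorr r.ρ (sch.β k) (2 * S + 1) E.F E.F S ≤
        CE * Real.exp (-(Δ * (sch.a k * S)))),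
      ∀ j, j ≤ S → latticeConnectedCorr r.ρ (sch.β k) (2 * S + 1) E.F E.F j ≤
        max CE (2 * (e0 * e0)) * θ ^ j := by
    intro E hE e0 CE he0 hEk j hj
    have h0 : latticeConnectedCorr r.ρ (sch.β k) (2 * S + 1) E.F E.F 0 ≤ max CE (2 * (e0 * e0)) :=
      (le_abs_self _).trans ((abs_latticeConnectedCorr_le r.ρ r.continuous _ S E E he0 he0 0).trans
        (le_max_right _ _))
    have hS' : latticeConnectedCorr r.ρ (sch.β k) (2 * S + 1) E.F E.F S ≤
        max CE (2 * (e0 * e0)) * Real.exp (-(Δ * sch.a k * S)) := by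
      have h := hEk S hS
      rw [show -(Δ * (sch.a k * (S : ℝ))) = -(Δ * sch.a k * S) by ring] at h
      exact h.trans (mul_le_mul_of_nonneg_right (le_max_left _ _) (Real.exp_pos _).le)
    have h := latticeConnectedCorr_self_le_exp_of_endpoints r.ρ r.continuous hβk hS1 E hE h0 hS' hj
    rw [show -(Δ * sch.a k * (j : ℝ)) = -(Δ * (sch.a k * j)) by ring, hθpow] at h
    exact h
  have hKF : ∀ j, j ≤ (2 * S + 1) / 2 → timeTwoPtSeq r.ρ (sch.β k)
      (fun U => toTorusObservable (2 * S + 1) A.F U -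
        wilsonExpectation r.ρ (sch.β k) (toTorusObservable (2 * S + 1) A.F)) j ≤ KA * θ ^ j := by
    intro j hj
    rw [← latticeConnectedCorr_eq_timeTwoPtSeq r.ρ r.continuous]
    exact hdiag A hA ha0 hAk j (by omega)
  have hKG : ∀ j, j ≤ (2 * S + 1) / 2 → timeTwoPtSeq r.ρ (sch.β k)
      (fun U => toTorusObservable (2 * S + 1) B.F U -
        wilsonExpectation r.ρ (sch.β k) (toTorusObservable (2 * S + 1) B.F)) j ≤ KB * θ ^ j := by
    intro j hj
    rw [← latticeConnectedCorr_eq_timeTwoPtSeq r.ρ r.continuous]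
    exact hdiag B hB hb0 hBk j (by omega)
  -- the Schwarz transfer (part 5)
  have hmix := timeTwoPtMixedSeq_sq_le_of_geometric r.ρ ⟨S, rfl⟩ (by omega) r.continuous hβk
    hFm hFb hF0 hGm hGb hG0 hθ hθ1 hKF hKG (n := n) (by omega)
  rw [← latticeConnectedCorr_eq_timeTwoPtMixedSeq r.ρ r.continuous] at hmix
  -- conclude
  rw [hθpow]
  have hKK : 0 ≤ KA * KB * Real.exp Δ := mul_nonneg (mul_nonneg hKA0 hKB0) (Real.exp_pos _).le
  apply abs_le_of_sq_le_sq _ (mul_nonneg (Real.sqrt_nonneg _) (pow_nonneg hθ.le _))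
  have hsq : (Real.sqrt (KA * KB * Real.exp Δ) * θ ^ n) ^ 2 = KA * KB * Real.exp Δ * θ ^ (2 * n) := by
    rw [mul_pow, Real.sq_sqrt hKK, ← pow_mul, mul_comm n 2]
  rw [hsq]
  calc latticeConnectedCorr r.ρ (sch.β k) (2 * S + 1) A.F B.F n ^ 2
      = θ * latticeConnectedCorr r.ρ (sch.β k) (2 * S + 1) A.F B.F n ^ 2 * θ⁻¹ := by
        field_simp
    _ ≤ KA * KB * θ ^ (2 * n) * θ⁻¹ :=
        mul_le_mul_of_nonneg_right hmix (inv_nonneg.mpr hθ.le)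
    _ ≤ KA * KB * θ ^ (2 * n) * Real.exp Δ :=
        mul_le_mul_of_nonneg_left hθinv (mul_nonneg (mul_nonneg hKA0 hKB0) (pow_nonneg hθ.le _))
    _ = KA * KB * Real.exp Δ * θ ^ (2 * n) := by ring

/-- **On the time-zero spatial algebra the clauses of `HasLatticeMassGap` are equivalent to
antipodal diagonal decay** (weak-coupling scheme, `Δ ≥ 0`, every compact `G`). [this unit's] -/
theorem latticeGapClause_timeZero_iff (r : LatticeRep G) {sch : SpeciesScheme (YMSpecies G)}
    (hw : sch.HasWeakCouplingLimit) {Δ : ℝ} (hΔ : 0 ≤ Δ) :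
    (∀ A B : YMSpecies G, IsTimeZeroSpatial A → IsTimeZeroSpatial B →
        LatticeGapClause r sch Δ A B) ↔
      ∀ A : YMSpecies G, IsTimeZeroSpatial A → HasAntipodalDecay r sch Δ A :=
  ⟨fun h A hA => (h A A hA hA).hasAntipodalDecay,
    fun h _ _ hA hB => latticeGapClause_of_hasAntipodalDecay r hw hΔ hA hB (h _ hA) (h _ hB)⟩

/-- In particular the lattice-gap conjunct of the summit contains antipodal decay of every
time-zero spatial species, and conversely antipodal decay of all of them gives back every
time-zero spatial clause. [this unit's] -/
theorem hasAntipodalDecay_of_hasLatticeMassGap {r : LatticeRep G}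
    {sch : SpeciesScheme (YMSpecies G)} {Δ : ℝ} (h : HasLatticeMassGap r sch Δ) (A : YMSpecies G) :
    HasAntipodalDecay r sch Δ A :=
  (LatticeGapClause.hasAntipodalDecay (h A A))

end Summit

end Summit.QuantumFields.YangMills.Theorems.SoloBlind

end
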